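import Summits.ResolutionOfSingularities.ResolutionOfSingularities.Theses.FrobeniusLadder
import Summits.ResolutionOfSingularities.ResolutionOfSingularities.Theorems.WeightedThesis.Negative.LoadBearing

/-!
# `FInjectiveMacaulayfication` — negative lemma: the depth half of the rung does not give the
# Frobenius half ("Cohen–Macaulay ⇒ F-injective" is false, already for curves)

Support (negative) lemma for crux `stmt-ResolutionOfSingularities-15315`
(`Summit.ResolutionOfSingularities.ResolutionOfSingularities.Theses.FrobeniusLadder.FInjectiveMacaulayfication`:
every reduced separated scheme of finite type over a field of characteristic `p` has a proper
birational model all of whose local rings are domains in which every system of parameters `s` is a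
weakly regular sequence AND generates a Frobenius-closed ideal), filed by the standing disprover
(cdisprove gen 1; work file `Cruxes/FInjectiveMacaulayfication/Disproof.lean`). This file declares
NO definition and NO notation.

The per-stalk clause of the crux is a conjunction "depth half ∧ Frobenius half". The rung BELOW the
crux — Macaulayfication (Faltings 1978 / Kawasaki 2000 / Česnavičius 2021) — delivers models whose
local rings satisfy the depth half. The natural shortcut for a prover is therefore the implication

  (CM ⇒ F-injective)  for every Noetherian local domain `R` of characteristic `p`, every `d` and
  every `s : Fin d → R` generating an ideal with maximal radical: if `s` is weakly regular then
  `(s)` is Frobenius closed (inline: `y^(p^e) ∈ span {z^(p^e) | z ∈ (s)}` for some `e` ⇒ `y ∈ (s)`),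

which together with Macaulayfication would prove the crux with `X' :=` any Cohen–Macaulay model.
(`d = dim R` is automatic here: a weakly regular sequence in `𝔪` generating an `𝔪`-primary ideal
has length `dim R`, so the shortcut is exactly "the crux's clause with its first conjunct moved into
the hypotheses".)

* `fInjectiveMacaulayfication_depthHalf_not_imp_frobeniusHalf` — **the shortcut is FALSE at every
  prime `p`, already in dimension one and for local rings essentially of finite type over `𝔽_p`**:
  in the local ring `R = 𝔽_p[T², T³]_(T², T³)` of the cuspidal cubic at its singular point (a
  one-dimensional Noetherian local domain, so Cohen–Macaulay), `s = (T²)` is a weakly regular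
  sequence with `rad (T²) = 𝔪`, and `(T³)^p = T^p · (T²)^p ∈ (T²)^[p]` (`T^p ∈ 𝔽_p[T², T³]` as
  `p ≥ 2`), but `T³ ∉ (T²)` (comparing `T³`-coefficients of `a · T² = T³ · v` with `v(0) ≠ 0`).
  So the Frobenius half is a genuine extra condition that a proof of the crux must CREATE by the
  modification (in dimension one: F-injective = weakly normal, and the cusp is not; its
  F-injective models are its (weak) normalisation `Spec 𝔽_p[T]`, not itself), and the output of
  Kawasaki's algorithm is not automatically a witness. Compare the route's calibration item
  `CPSpecimenNotFClosed` (a NORMAL four-dimensional hypersurface failing the Frobenius half).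

Helper lemmas (`cusp_*`) are stated for a subalgebra `A ⊆ K[T]` whose elements are exactly the
polynomials without linear term (`hA`), i.e. `A = K[T², T³] = Algebra.adjoin K {T², T³}`
(`cusp_mem_adjoin_iff`, using the landed `WeightedThesis.Negative.cusp_coeff_one_eq_zero`), and a
maximal ideal `P` of `A` consisting of the elements vanishing at `0` (`hP`).

## Sources
* R. Fedder, *F-purity and rational singularity*, Trans. AMS 278 (1983), 461–480 (F-injectivity
  of Cohen–Macaulay rings via Frobenius closure of parameter ideals, Remark after Prop. 1.3).
* P. H. Quy, K. Shimomoto, Adv. Math. 313 (2017) = arXiv:1601.02524, §2 (Frobenius closure,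
  `I^[q]`, "CM ⇒ (F-injective ⇔ every parameter ideal Frobenius closed)").
* K. Schwede, *F-injective singularities are Du Bois*, Amer. J. Math. 131 (2009), Thm. 4.7
  (F-injective ⇒ weakly normal) — context for "the cusp is the minimal specimen"; not used.
-/

noncomputable section

open Polynomial IsLocalRing

set_option linter.dupNamespace false

namespace Summit.ResolutionOfSingularities.ResolutionOfSingularities.Theorems.FInjectiveMacaulayfication.Negative

section Cusp

variable (K : Type) [Field K]

/-- `Tⁿ ∈ K[T², T³]` for `n ≠ 1` (`n = 2a` or `n = 2b + 3`). [folklore] -/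
theorem cusp_X_pow_mem {n : ℕ} (hn : n ≠ 1) :
    (X ^ n : K[X]) ∈ Algebra.adjoin K ({X ^ 2, X ^ 3} : Set K[X]) := by
  have h2 : (X ^ 2 : K[X]) ∈ Algebra.adjoin K ({X ^ 2, X ^ 3} : Set K[X]) :=
    Algebra.subset_adjoin (by simp)
  have h3 : (X ^ 3 : K[X]) ∈ Algebra.adjoin K ({X ^ 2, X ^ 3} : Set K[X]) :=
    Algebra.subset_adjoin (by simp)
  rcases Nat.even_or_odd n with ⟨a, rfl⟩ | ⟨a, rfl⟩
  · have : (X : K[X]) ^ (a + a) = (X ^ 2) ^ a := by ring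
    rw [this]
    exact Subalgebra.pow_mem _ h2 a
  · obtain ⟨b, rfl⟩ : ∃ b, a = b + 1 := ⟨a - 1, by omega⟩
    have : (X : K[X]) ^ (2 * (b + 1) + 1) = (X ^ 2) ^ b * X ^ 3 := by ring
    rw [this]
    exact Subalgebra.mul_mem _ (Subalgebra.pow_mem _ h2 b) h3

/-- **`K[T², T³]` is the set of polynomials without linear term.** (`→`: the landed
`WeightedThesis.Negative.cusp_coeff_one_eq_zero`; `←`: `s = Σ_{n ≠ 1} s_n Tⁿ`.) [folklore] -/
theorem cusp_mem_adjoin_iff (s : K[X]) :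
    s ∈ Algebra.adjoin K ({X ^ 2, X ^ 3} : Set K[X]) ↔ s.coeff 1 = 0 := by
  refine ⟨Summit.ResolutionOfSingularities.ResolutionOfSingularities.Theorems.WeightedThesis.Negative.cusp_coeff_one_eq_zero
    K, fun hs => ?_⟩
  rw [s.as_sum_support_C_mul_X_pow]
  refine Subalgebra.sum_mem _ fun n _ => ?_
  by_cases hn : n = 1
  · subst hn
    rw [hs, map_zero, zero_mul]
    exact Subalgebra.zero_mem _
  · rw [← Polynomial.smul_eq_C_mul]
    exact Subalgebra.smul_mem _ (cusp_X_pow_mem K hn) _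

/-- `K[T², T³]` is Noetherian (a finitely generated `K`-algebra). [folklore] -/
theorem cusp_isNoetherianRing :
    IsNoetherianRing ↥(Algebra.adjoin K ({X ^ 2, X ^ 3} : Set K[X])) := by
  classical
  haveI : Algebra.FiniteType K ↥(Algebra.adjoin K ({X ^ 2, X ^ 3} : Set K[X])) :=
    ⟨(Subalgebra.fg_top _).mpr ⟨{(X ^ 2 : K[X]), X ^ 3}, by simp⟩⟩
  exact Algebra.FiniteType.isNoetherianRing K _

variable {K}
variable (A : Subalgebra K K[X]) (P : Ideal ↥A) [P.IsMaximal]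

/-- In the local ring at the origin `P = {s | s(0) = 0}` of a subalgebra `A = {s | s.coeff 1 = 0}`
of `K[T]`: `rad (T²) = 𝔪` (every `f ∈ P` is `T² g`, and `f² = T² · (T² g²)` with `T² g² ∈ A`).
[folklore] -/
theorem cusp_radical_span_sq (hA : ∀ s : K[X], s ∈ A ↔ s.coeff 1 = 0)
    (hP : ∀ s : ↥A, s ∈ P ↔ (s : K[X]).coeff 0 = 0) (h2 : (X ^ 2 : K[X]) ∈ A) :
    (Ideal.span {algebraMap ↥A (Localization.AtPrime P) ⟨X ^ 2, h2⟩}).radical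
      = maximalIdeal (Localization.AtPrime P) := by
  apply le_antisymm
  · have ht2 : algebraMap ↥A (Localization.AtPrime P) ⟨X ^ 2, h2⟩ ∈
        maximalIdeal (Localization.AtPrime P) := by
      rw [← Localization.AtPrime.map_eq_maximalIdeal]
      exact Ideal.mem_map_of_mem _ ((hP _).mpr (by simp))
    calc _ ≤ (maximalIdeal (Localization.AtPrime P)).radical :=
          Ideal.radical_mono ((Ideal.span_singleton_le_iff_mem _).mpr ht2)
      _ = maximalIdeal (Localization.AtPrime P) := (maximalIdeal.isMaximal _).isPrime.radical
  · rw [← Localization.AtPrime.map_eq_maximalIdeal, Ideal.map_le_iff_le_comap]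
    intro f hf
    rw [Ideal.mem_comap]
    refine ⟨2, ?_⟩
    have h0 : (f : K[X]).coeff 0 = 0 := (hP f).mp hf
    have h1 : (f : K[X]).coeff 1 = 0 := (hA _).mp f.2
    obtain ⟨g, hg⟩ : (X : K[X]) ^ 2 ∣ (f : K[X]) := by
      rw [Polynomial.X_pow_dvd_iff]
      intro d hd
      interval_cases d <;> assumption
    have hmem : X ^ 2 * g ^ 2 ∈ A := (hA _).mpr (by rw [Polynomial.coeff_X_pow_mul']; simp)
    have hf2 : f ^ 2 = ⟨X ^ 2, h2⟩ * ⟨X ^ 2 * g ^ 2, hmem⟩ := by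
      apply Subtype.ext
      simp only [Subalgebra.coe_pow, Subalgebra.coe_mul, hg]
      ring
    rw [← map_pow, hf2, map_mul]
    exact Ideal.mul_mem_right _ _ (Ideal.subset_span rfl)

/-- In the same local ring, `T³ ∉ (T²)`: clearing denominators gives `a · T² = T³ · v` in `A`
with `v(0) ≠ 0`, and the `T³`-coefficients read `0 = a.coeff 1 = v.coeff 0 ≠ 0`. [folklore] -/
theorem cusp_cube_not_mem_span_sq (hA : ∀ s : K[X], s ∈ A ↔ s.coeff 1 = 0)
    (hP : ∀ s : ↥A, s ∈ P ↔ (s : K[X]).coeff 0 = 0) (h2 : (X ^ 2 : K[X]) ∈ A)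
    (h3 : (X ^ 3 : K[X]) ∈ A) :
    algebraMap ↥A (Localization.AtPrime P) ⟨X ^ 3, h3⟩ ∉
      Ideal.span {algebraMap ↥A (Localization.AtPrime P) ⟨X ^ 2, h2⟩} := by
  haveI : IsDomain (Localization.AtPrime P) :=
    IsLocalization.isDomain_of_local_atPrime inferInstance
  intro h
  obtain ⟨a, ha⟩ := Ideal.mem_span_singleton'.mp h
  obtain ⟨⟨num, den⟩, hnd⟩ := IsLocalization.surj P.primeCompl a
  have h1 : algebraMap ↥A (Localization.AtPrime P) (num * (⟨X ^ 2, h2⟩ : ↥A)) =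
      algebraMap ↥A (Localization.AtPrime P) ((⟨X ^ 3, h3⟩ : ↥A) * (den : ↥A)) := by
    rw [map_mul, map_mul, ← hnd, ← ha]
    ring
  have h2' := congrArg Subtype.val
    (IsLocalization.injective (Localization.AtPrime P) P.primeCompl_le_nonZeroDivisors h1)
  simp only [Subalgebra.coe_mul] at h2'
  have h3' : ((num : K[X]) * X ^ 2).coeff 3 = (X ^ 3 * (den : K[X])).coeff 3 := by rw [h2']
  rw [Polynomial.coeff_mul_X_pow', Polynomial.coeff_X_pow_mul'] at h3'
  norm_num at h3'
  have hnum : (num : K[X]).coeff 1 = 0 := (hA _).mp num.2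
  have hden : (den : K[X]).coeff 0 ≠ 0 := fun h0 => den.2 ((hP _).mpr h0)
  exact hden (h3' ▸ hnum)

/-- In the same local ring, `(T³)^p ∈ span {z^p | z ∈ (T²)}` whenever `T^p ∈ A`
(`(T³)^p = T^p · (T²)^p`). [folklore] -/
theorem cusp_cube_pow_mem {p : ℕ} (h2 : (X ^ 2 : K[X]) ∈ A) (h3 : (X ^ 3 : K[X]) ∈ A)
    (hXp : (X ^ p : K[X]) ∈ A) :
    algebraMap ↥A (Localization.AtPrime P) ⟨X ^ 3, h3⟩ ^ p ∈
      Ideal.span ((fun z : Localization.AtPrime P => z ^ p) ''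
        (Ideal.span {algebraMap ↥A (Localization.AtPrime P) ⟨X ^ 2, h2⟩} :
          Set (Localization.AtPrime P))) := by
  have key : algebraMap ↥A (Localization.AtPrime P) ⟨X ^ 3, h3⟩ ^ p =
      algebraMap ↥A (Localization.AtPrime P) ⟨X ^ p, hXp⟩ *
        algebraMap ↥A (Localization.AtPrime P) ⟨X ^ 2, h2⟩ ^ p := by
    rw [← map_pow, ← map_pow, ← map_mul]
    congr 1
    apply Subtype.ext
    simp only [SubmonoidClass.mk_pow, Subalgebra.coe_mul]
    ring
  rw [key]
  exact Ideal.mul_mem_left _ _ (Ideal.subset_span ⟨_, Ideal.subset_span rfl, rfl⟩)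

end Cusp

/-- **Natural strengthening of `FInjectiveMacaulayfication` refuted at every prime — the depth half
of the rung does not imply its Frobenius half ("Cohen–Macaulay ⇒ F-injective" is false).** It is NOT
true that for every Noetherian local domain `R` of characteristic `p`, every `d` and every
`s : Fin d → R` with `rad (s)` maximal, weak regularity of `s` forces `(s)` to be Frobenius closed in
the crux's inline sense. Witness: the local ring of the cuspidal cubic `𝔽_p[T², T³]` at the origin,
`d = 1`, `s = (T²)`, `y = T³` (`(T³)^p ∈ (T²)^[p]`, `T³ ∉ (T²)`). Hence a Cohen–Macaulay model
(Macaulayfication) is not automatically a witness for the crux; the modification must change the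
non-F-injective (here: non-weakly-normal) points. [folklore; cite: QuyShimomoto2017, §2] -/
theorem fInjectiveMacaulayfication_depthHalf_not_imp_frobeniusHalf (p : ℕ) [hp : Fact p.Prime] :
    ¬ ∀ (R : Type) [CommRing R] [IsDomain R] [IsNoetherianRing R] [IsLocalRing R] [CharP R p]
        (d : ℕ) (s : Fin d → R), (Ideal.span (Set.range s)).radical.IsMaximal →
        RingTheory.Sequence.IsWeaklyRegular R (List.ofFn s) →
        ∀ y : R, (∃ e : ℕ, y ^ p ^ e ∈ Ideal.span ((fun z : R => z ^ p ^ e) ''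
          (Ideal.span (Set.range s) : Set R))) → y ∈ Ideal.span (Set.range s) := by
  intro h
  -- the cusp algebra `A = 𝔽_p[T², T³]`, its origin `P`, and the local ring `R = A_P`
  let A : Subalgebra (ZMod p) (ZMod p)[X] :=
    Algebra.adjoin (ZMod p) ({X ^ 2, X ^ 3} : Set (ZMod p)[X])
  have hA : ∀ s : (ZMod p)[X], s ∈ A ↔ s.coeff 1 = 0 := cusp_mem_adjoin_iff (ZMod p)
  let φ : ↥A →ₐ[ZMod p] ZMod p := (Polynomial.aeval (0 : ZMod p)).comp A.val
  have hφ : Function.Surjective φ := fun r => ⟨algebraMap (ZMod p) ↥A r, by simp [φ]⟩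
  let P : Ideal ↥A := RingHom.ker φ.toRingHom
  haveI hPmax : P.IsMaximal := RingHom.ker_isMaximal_of_surjective _ hφ
  have hP : ∀ s, s ∈ P ↔ (s : (ZMod p)[X]).coeff 0 = 0 := fun s => by
    change φ s = 0 ↔ _
    simp [φ, Polynomial.coeff_zero_eq_eval_zero]
  haveI : IsDomain (Localization.AtPrime P) :=
    IsLocalization.isDomain_of_local_atPrime inferInstance
  haveI : IsNoetherianRing ↥A := cusp_isNoetherianRing (ZMod p)
  haveI : IsNoetherianRing (Localization.AtPrime P) :=
    IsLocalization.isNoetherianRing P.primeCompl _ inferInstance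
  haveI : CharP (Localization.AtPrime P) p :=
    CharP.of_ringHom_of_ne_zero
      ((algebraMap ↥A (Localization.AtPrime P)).comp (algebraMap (ZMod p) ↥A)) p hp.out.ne_zero
  -- the parameter `T²` and the element `T³`
  have h2 : (X ^ 2 : (ZMod p)[X]) ∈ A := cusp_X_pow_mem (ZMod p) (by decide)
  have h3 : (X ^ 3 : (ZMod p)[X]) ∈ A := cusp_X_pow_mem (ZMod p) (by decide)
  let t2 : Localization.AtPrime P := algebraMap ↥A _ ⟨X ^ 2, h2⟩
  let t3 : Localization.AtPrime P := algebraMap ↥A _ ⟨X ^ 3, h3⟩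
  have ht2 : t2 ≠ 0 := by
    intro h0
    have := congrArg Subtype.val
      ((IsLocalization.injective (Localization.AtPrime P) P.primeCompl_le_nonZeroDivisors)
        (h0.trans (map_zero _).symm))
    simp at this
  have hrange : Set.range (fun _ : Fin 1 => t2) = {t2} := Set.range_const
  have hreg : RingTheory.Sequence.IsWeaklyRegular (Localization.AtPrime P)
      (List.ofFn fun _ : Fin 1 => t2) := by
    rw [List.ofFn_const, List.replicate_one, RingTheory.Sequence.isWeaklyRegular_cons_iff]
    exact ⟨fun a b hab => mul_left_cancel₀ ht2 hab, RingTheory.Sequence.IsWeaklyRegular.nil _ _⟩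
  have key := h (Localization.AtPrime P) 1 (fun _ => t2)
    (by rw [hrange, cusp_radical_span_sq A P hA hP h2]; exact maximalIdeal.isMaximal _)
    hreg t3 ⟨1, by
      rw [hrange, pow_one]
      exact cusp_cube_pow_mem A P h2 h3 (cusp_X_pow_mem (ZMod p) hp.out.one_lt.ne')⟩
  rw [hrange] at key
  exact cusp_cube_not_mem_span_sq A P hA hP h2 h3 key

end Summit.ResolutionOfSingularities.ResolutionOfSingularities.Theorems.FInjectiveMacaulayfication.Negative

end
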